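import Summits.QuantumFields.BalabanUV.T4Continuum.Spine.NE1p.DressedTerminalWitnessReuse

/-!
# T⁴ programme, spine estimate NE1′ (node O3b/H2) — A MET COMPONENT OF TWO CUBES, part 1 of 2: a decided function-level toy whose met
# component is HOUSED IN TWO CUBES at every live scale (`v = 2`) — booking, tower, anchoring at two adjacent blocks straddling every
# block boundary, housing that NEEDS both cubes, the live two-term dictionary, the booking convention
# (swarm witness «W17», census slot (δ) of `t4/formal/NE1p/LEAVES.md` ∕ typer R-T65 (i); INTENT CLAIMS.log l.12373) [decided toy]

Cell `pub-balaban`, sub-cell `t4`, BINDER-OWNERS row NE1′ (owner lineage t4-ne1p-p1); formalisation crew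
`b2b-balaban-t4-ne1p-formalise-*`, seat `…-leaf-01` (gen 6; lineage rows S2 ∕ S2b ∕ S2c ∕ S2d ∕ S2i ∕ S2j ∕ W6 ∕ S2k ∕ S3m, the
SATURATION CENSUS `t4/b2b-balaban-t4-ne1p-formalise-leaf-01/g5/SATURATION-CENSUS-NE1p-witnesses.md` adopted by R-T65 (i)).
ADDITIVE — imports leaf-02-g4's row W11r part 1 `Spine/NE1p/DressedTerminalWitnessReuse` (p216180) ONLY: its integer-window arithmetic
(`one_le_natL` ∕ `natL_pos` ∕ `psi_le_psiL` ∕ `tau_pow_le` ∕ `hloc_int` ∕ `hρ'_int`), the cut exponent `𝒬T` with the step law `hFnT`,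
the booking-convention lemmas `osc_le` ∕ `osc_dirW` ∕ `hneM` — reused BY NAME, nothing duplicated; through it S3l
`DressedStabilityOfCanonicalSliceWinSchedules` p215128 (the canonical terminal face; `T4FeltGeometry.Anchoring` ∕ `coarsen`), leaf-03's
W7 `DressedTowerWitnessSlice{,End}` p214558 (the one-family datum `aM` ∕ `cM` ∕ `FnM` ∕ `𝒬M` ∕ `shiftM` ∕ `Wm` ∕ `atomW` ∕ `defW` ∕ `dfW` ∕
`dirW`, `FnM_succ`, `hslM`, `relGauge_pairs`, `zero_mem_windowM`; W5's `flAt` calculus, `zeroExp`, `LW`) and leaf-07-g2's S3c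
`DressedCellNecessity` p213339; modifies nothing.  Pattern = leaf-09-g4's W14 `DressedTowerWitnessBlocks` p216469 (a transplant of W7's
function-level content onto a new booking), here with TWO families and TWO cubes per scale.
Part 2 = `Spine/NE1p/DressedTowerWitnessTwoCubesEnd.lean` (the canonical terminal face APPLIED at every integer `81 ≤ Lb ≤ 120`, with
ROOT-C OF RECORD `DressedRoot.DressedStabilityStrict` (owner, p216910) concluded BY NAME).

WHY (census slot (δ), LOCATED with file and line).  In the canonical terminal face S3l
(`Spine/NE1p/DressedStabilityOfCanonicalSliceWinSchedules.lean` p215128) the (w3-book) L-C anchoring DATA carry a met-component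
VOLUME: l.188–189 `{Lb mB v : ℕ}`, `comp : … → Finset Cube`; l.262 `hhoused : ∀ k b, ∀ f ∈ S k b, ∃ q ∈ comp k b, f ∈ feltAt q`;
l.263 `hvol : (comp k b).card ≤ v`; l.292 `hvN₀ : (v:ℝ)·mB ≤ N₀`.  In EVERY terminal-face witness of the crew (W11 `compT`, W11r
`compM K k b = {⟨k,_⟩}`, W13 (v = 1, mB = 2), W14 `compP` ∕ `hvolP … ≤ 1` — `Lb⁴` families coarsened into ONE cube; W15 ∕ W16 as booked)
`v = 1`: every met component is housed in ONE cube, `hhoused`'s «∃ q ∈ comp» never chooses, `hvol` never exceeds `1`, and `hvN₀` is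
exercised only as `1·mB ≤ N₀` (census F7, 4∕4 terminal ENDs).  THIS TOY: two families `0, 1 : Fin 2` born at scale `0`, ANCHORED AT
THE TWO ADJACENT UNIT BLOCKS `x₀ = (Lb^K − 1)·e₀`, `x₁ = Lb^K·e₀` of `ℕ⁴` — a pair STRADDLING THE BLOCK BOUNDARY AT `Lb^K` OF EVERY
BLOCKING LEVEL `k ≤ K` (`center_fst_lt`: the two cubes of scale `k` sit at the DISTINCT blocks `Lb^{K−k} − 1` and `Lb^{K−k}` along
axis `0`; `2 ≤ Lb`); cubes `Fin (K+1) × Fin 2`, cube `(k, i)` centred at `coarsen Lb k xᵢ` and feeling family `i` ONLY; per-block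
multiplicity `mB = 1` (distinct blocks, `hmultD`); the met component is the PAIR from birth: live families `S k b = {0, 1}`, housed in
**`comp K k b = {(k,0), (k,1)}` — TWO cubes at EVERY live scale (`compD_card`: `hvol ≤ 2` ATTAINED), and NO single cube houses the
component (`not_housed_by_one_cube`: `feltAt q` is a singleton) — so `v = 2` is NECESSARY, `hhoused` CHOOSES the cube `(k, f)` of the
family `f`, and part 2 runs `hvN₀` as `2·1 ≤ N₀ = 2`**, the derived positional count `#{live families of scale j at k} ≤ 2·(Lb⁴)^{k−j}`
being ATTAINED at `k = j = 0`.  Function-level content = W7's BY NAME for both families (affine carried functional `FnM`, two-atom laws,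
ONE cutoff-free schedule `Wm`); the H2 dictionary is the LIVE TWO-TERM cross-family sum `⅛·Σ_{(f,0), f ∈ {0,1}} (FnM K 0 k (U+z) −
FnM K 0 k (U+0))`, which EQUALS W7's `𝒬M K k = ¼·a_K·z₀₀` (`hQD`) — so W11r's cut step law `hFnT` serves both families VERBATIM; source
factor `c = ⅛ ≤ m = ⅛`, whence part 2's (w6) window `⅛·(2·1·(1−¾)⁻¹) = 1 ≤ 1 − 0` (EQUALITY) keeps `m·N₀·A₀ = ¼` and the SAME
integer window `81 ≤ Lb ≤ 120` as W11r ∕ W14 (LF-4, leaf-07-g5's S3c.1 threshold unchanged).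
* §1 the two blocks, the coarsening separating them at every level; §2 booking `BD K`, trajectory `TD K`, tower `towerD` (cutoff-indexed,
  `Lb`-free); §3 anchoring `anchD K Lb`, `hmultD`, `center_fst_lt`; met components `compD` (TWO cubes), live families `SD` ∕ generations
  `SgD`, `hscaleD` ∕ `hvolD` ∕ `compD_card` ∕ `hhousedD` ∕ `not_housed_by_one_cube` ∕ `hSgD` ∕ `liveFamilies_card`; §4 the dictionary
  `hQD`, `hcmD`; §5 births `hslD`, the booking convention (`lin_eq_increment`, `hsupD`), the absorption door `habsD` (EQUALITY), no
  regeneration `hregD`.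

HONEST FRAMING.  A decided toy ([folklore]; 0 sorry; 0 citations; no `def … : Prop` — the `def`s are toy ∕ instantiation DATA);
NOTHING of Bałaban's localisation domains, large-field met components, D-terms or windows is modelled or asserted: «two adjacent unit
blocks of a decided toy — NOT Bałaban's large-field components; `Lb` is the toy's integer, not Bałaban's L» (k2).  DECLARED ≡ 0 (their
live corners elsewhere): action exponent `𝒜 ≡ 0` (W9 ∕ W12), action margins `s ≡ 0`, regeneration `creg ≡ 0` (W10), absorbed sets
`Sabs ≡ ∅` ∕ `A = 0` (W13), `rel = Eq` (W15), constant base `base ≡ 1`, two-atom laws (W16 booked on (γ)), `z₀ = z₁ = 0`, `q ≡ 0`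
(census slots (α)∕(ε) NOT ridden).  Headline (c4): «a met component of TWO cubes is housed, counted and budgeted: `hhoused` ∕ `hvol` ∕
`hvN₀` exercised with `v = 2` on a decided toy (part 2: the canonical terminal face fires at every integer `81 ≤ Lb ≤ 120` and ROOT-C of
record `DressedStabilityStrict towerD (Lb⁴)` follows BY NAME); non-vacuity of SHAPES only — NE1′ ⇐ the named binders, NOT proved, NOT
printed; 0 binders instantiated on Bałaban's densities»; spine PROVED 0∕9.  Rung (B)+1 on ONE finite four-torus — NOT infinite
volume, NOT a mass gap, NOT OS on ℝ⁴, NOT Clay, NOT summit progress.  HONEST DEPENDENCY: continuum YM on T⁴ ⇐ BetaPertH ∧ nine spine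
estimates (0/9 proved); BetaPertH ⇐ (D1) ∧ (D4) ∧ CAP+tail; G-an2-4 gates asym, D1 and NE2/3/4.
-/

noncomputable section

namespace Summit.QuantumFields.BalabanUV.T4Continuum.NE1p.DressedTowerWitnessTwoCubes

open MeasureTheory Set Metric Filter Finset
open scoped BigOperators
open Literature.MathematicalPhysics.QuantumFieldTheory.Balaban1983to89
open Literature.MathematicalPhysics.QuantumFieldTheory.Balaban1983to89.T4TermFormat
open Literature.MathematicalPhysics.QuantumFieldTheory.Balaban1983to89.T4TermFormat.Booking
open Literature.MathematicalPhysics.QuantumFieldTheory.Balaban1983to89.T4FeltGeometry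
open Literature.MathematicalPhysics.QuantumFieldTheory.Balaban1983to89.T4GatedBooking
open Literature.MathematicalPhysics.QuantumFieldTheory.Balaban1983to89.T4TrajectoryComparison
open T4TrajectoryModulus (bondBall bondBall_add_mem bondBall_latMove_add_mem bondBall_diam)
open T4BlockTransport (Fld NDir latMove latN Site norm_dir_le)
open T4BirthChartTransport (GaugeInvariant BirthSlice RelGauge)
open T4TrajectoryDensity
open Summit.QuantumFields.BalabanUV.T4Continuum.T4TrajectoryDensityDressed
open Summit.QuantumFields.BalabanUV.T4Continuum.T4TrajectoryDensityWitness
open Summit.QuantumFields.BalabanUV.T4Continuum.NE1p.DressedRoot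
open Summit.QuantumFields.BalabanUV.T4Continuum.NE1p.DressedUniformConstants
open Summit.QuantumFields.BalabanUV.T4Continuum.NE1p.DressedWindowScheduleWin
open Summit.QuantumFields.BalabanUV.T4Continuum.NE1p.DressedWindowScheduleModWin
open Summit.QuantumFields.BalabanUV.T4Continuum.NE1p.DressedTowerWitness
open Summit.QuantumFields.BalabanUV.T4Continuum.NE1p.DressedTowerWitnessSlice
open Summit.QuantumFields.BalabanUV.T4Continuum.NE1p.DressedTerminalWitnessReuse

/-! ## §1 Two adjacent unit blocks straddling the block boundary at `Lb^K` of every blocking level [folklore] -/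

/-- THE TWO BLOCKS [decided toy]: family `i ∈ {0, 1}` is localised at the unit block `xᵢ = (Lb^K − 1 + i)·e₀` of `ℕ⁴` — two ADJACENT
blocks along axis `0`, on either side of the boundary at `Lb^K`. [folklore] -/
def blk (K Lb : ℕ) (i : Fin 2) : Fin 4 → ℕ := fun j => if j = 0 then Lb ^ K - 1 + i.val else 0

/-- The two blocks are distinct (their axis-`0` coordinates differ by one). [folklore] -/
theorem blk_injective (K Lb : ℕ) : Function.Injective (blk K Lb) := by
  intro a b h
  have h0 := congrFun h 0
  simp only [blk, ↓reduceIte] at h0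
  exact Fin.ext (by omega)

/-- **THE COARSENING SEPARATES THE PAIR AT EVERY LEVEL** [folklore]: for `1 ≤ Lb` and `k ≤ K`, the `k`-fold coarsened axis-`0`
coordinate of `x₀` is STRICTLY below that of `x₁` (`⌊(Lb^K − 1)∕Lb^k⌋ < Lb^{K−k} = ⌊Lb^K∕Lb^k⌋`) — the pair straddles the block
boundary at `Lb^K` of every blocking level up to the cutoff. -/
theorem coarsen_blk_fst_lt {K Lb k : ℕ} (hLb : 1 ≤ Lb) (hk : k ≤ K) :
    coarsen Lb k (blk K Lb 0) 0 < coarsen Lb k (blk K Lb 1) 0 := by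
  have hpos : 0 < Lb ^ k := Nat.pos_of_ne_zero (pow_ne_zero k (by omega))
  have hKpos : 0 < Lb ^ K := Nat.pos_of_ne_zero (pow_ne_zero K (by omega))
  simp only [coarsen_apply, blk, ↓reduceIte, Fin.val_zero, Fin.val_one, add_zero]
  rw [Nat.sub_add_cancel hKpos, Nat.pow_div hk (by omega), Nat.div_lt_iff_lt_mul hpos, ← pow_add, Nat.sub_add_cancel hk]
  exact Nat.sub_lt hKpos Nat.one_pos

/-! ## §2 The datum: two families born at scale `0`, W7's sizes per family, TWO cubes at every scale [decided toy] -/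

/-- TOY BOOKING at cutoff `K` with TWO families [decided toy]: family `i : Fin 2` born at scale `0`, localised at its block; cubes
`Fin (K+1) × Fin 2`: at EVERY scale `k ≤ K` TWO cubes `(k, 0)`, `(k, 1)`, cube `(k, i)` feeling family `i` ONLY; every family has W7's
POSITIVE size `a_K·ψ_W^{k+1}∕2` at scale `k`.  Independent of the blocking integer.  Nothing of Bałaban's is modelled. [folklore] -/
def BD (K : ℕ) : T4TermFormat.Booking where
  K := K
  Dom := Fin 2
  domScale := fun _ => 0
  treeLen := fun _ => 0
  treeLen_nonneg := fun _ => le_rfl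
  balSize := fun _ => 0
  Birth := Fin 2
  births := Finset.univ
  mem_births := fun b => Finset.mem_univ b
  birthScale := fun _ => 0
  birth_le := fun _ => Nat.zero_le K
  loc := id
  loc_scale := fun _ => rfl
  Cube := Fin (K + 1) × Fin 2
  cubes := Finset.univ
  mem_cubes := fun q => Finset.mem_univ q
  cubeScale := fun q => q.1.val
  cube_le := fun q => Nat.lt_succ_iff.mp q.1.isLt
  feltAt := fun q => {q.2}
  felt_birth_le := fun _ _ _ => Nat.zero_le _
  size := fun _ k => aM K * defW (k + 1)
  size_nonneg := fun _ k => (mul_pos (aM_pos K) (defW_pos (k + 1))).le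
  pair := fun _ _ _ => 0

/-- TOY TRAJECTORY [decided toy]: per family W7's one generation (the birth, size `a_K·(c_M + 3)`) and `lin f 0 k = a_K·ψ_W^{k+1}∕2`.
[folklore] -/
def TD (K : ℕ) : Trajectory (BD K) where
  lin := fun _ k' k => if k' = 0 then aM K * defW (k + 1) else 0
  lin_nonneg := fun _ k' k => by
    split_ifs
    · exact (mul_pos (aM_pos K) (defW_pos (k + 1))).le
    · exact le_rfl
  gen := fun _ k' => if k' = 0 then aM K * (cM + 3) else 0
  gen_nonneg := fun _ k' => by
    split_ifs
    · exact (mul_pos (aM_pos K) (by linarith [cM_pos])).le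
    · exact le_rfl
  size_le := fun b k _ _ => by
    show aM K * defW (k + 1) ≤ ∑ k' ∈ Icc 0 k, (if k' = 0 then aM K * defW (k + 1) else 0)
    rw [Finset.sum_ite_eq' (Icc 0 k) 0 (fun _ => aM K * defW (k + 1))]
    simp

/-- TOY TOWER with two families and two cubes per scale [decided toy]: the datum at every cutoff (one run parameter); `Lb`-free — the
SAME tower meets the terminal face at every integer of the window (part 2). [folklore] -/
def towerD : DressedTower Unit where
  B := fun _ K => BD K
  K_eq := fun _ _ => rfl
  T := fun _ K => TD K

/-- The toy is non-degenerate: every booked size of both families is positive at every cutoff and scale. [folklore] -/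
theorem towerD_size_pos (K k : ℕ) (f : (BD K).Birth) : 0 < (BD K).size f k := mul_pos (aM_pos K) (defW_pos (k + 1))

/-! ## §3 The anchoring at two adjacent blocks, met components of TWO cubes, live families, the dictionary's data [decided toy] -/

/-- **THE ANCHORING ON `ℕ⁴` WITH BLOCKING INTEGER `Lb`** [decided toy]: family `i` is localised at the block `xᵢ` of scale `0`; the cube
`(k, i)` is centred at the `k`-fold coarsening `coarsen Lb k xᵢ` of its family's block and feels that family only (`felt_under` by the
coarsening itself).  By `coarsen_blk_fst_lt` the two cubes of every scale `k ≤ K` sit at DISTINCT blocks (`1 ≤ Lb`).  Genuine anchoring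
data; nothing of Bałaban's localisation domains. [folklore] -/
def anchD (K Lb : ℕ) : Anchoring (BD K) 4 Lb where
  dom := fun f => {blk K Lb f}
  center := fun q => coarsen Lb q.1.val (blk K Lb q.2)
  felt_under := fun q f hf => by
    have hfq : f = q.2 := Finset.mem_singleton.mp hf
    subst hfq
    exact ⟨blk K Lb q.2, Finset.mem_singleton_self _, rfl⟩

/-- **PER-BLOCK MULTIPLICITY `mB = 1`** [decided toy]: a block lies in the domain of at most one family — the two families sit at
DISTINCT blocks (`blk_injective`). [folklore] -/
theorem hmultD (K Lb : ℕ) : ∀ j (x : Fin 4 → ℕ),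
    ((BD K).births.filter fun b => (BD K).birthScale b = j ∧ x ∈ (anchD K Lb).dom b).card ≤ 1 := by
  intro j x
  refine Finset.card_le_one.mpr fun a ha b hb => ?_
  have ha' : x ∈ ({blk K Lb a} : Finset (Fin 4 → ℕ)) := (Finset.mem_filter.mp ha).2.2
  have hb' : x ∈ ({blk K Lb b} : Finset (Fin 4 → ℕ)) := (Finset.mem_filter.mp hb).2.2
  rw [Finset.mem_singleton] at ha' hb'
  exact blk_injective K Lb (ha'.symm.trans hb')

/-- **THE TWO CUBES OF ONE SCALE SIT AT DISTINCT BLOCKS** [decided toy]: for `1 ≤ Lb` and `k ≤ K` the centres of `(k, 0)` and `(k, 1)`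
differ (in the axis-`0` coordinate) — the met component genuinely spans two blocks of the current scale, at every live scale. [folklore] -/
theorem center_fst_lt {K Lb : ℕ} (hLb : 1 ≤ Lb) (k : Fin (K + 1)) :
    (anchD K Lb).center (k, 0) 0 < (anchD K Lb).center (k, 1) 0 :=
  coarsen_blk_fst_lt hLb (Nat.lt_succ_iff.mp k.isLt)

/-- MET COMPONENTS [decided toy]: at every scale `k ≤ K` the TWO cubes `(k, 0)`, `(k, 1)` of the scale; none above the cutoff.
Volume `v = 2`. [folklore] -/
def compD (K k : ℕ) (_b : Fin 2) : Finset (Fin (K + 1) × Fin 2) :=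
  if h : k ≤ K then {(⟨k, Nat.lt_succ_of_le h⟩, 0), (⟨k, Nat.lt_succ_of_le h⟩, 1)} else ∅

/-- LIVE FAMILIES of the met component of `b` at step `k` [decided toy]: BOTH families at every scale `k ≤ K` (the pair is met from
birth), none above the cutoff. [folklore] -/
def SD (K k : ℕ) (_b : Fin 2) : Finset (Fin 2) := if k ≤ K then Finset.univ else ∅

/-- LIVE GENERATIONS of the met component [decided toy]: both families' (only) generation `0`. [folklore] -/
def SgD (K k : ℕ) (_b : Fin 2) : Finset (Fin 2 × ℕ) := if k ≤ K then Finset.univ ×ˢ {0} else ∅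

/-- [folklore] The component's cubes have the current scale. -/
theorem hscaleD (K : ℕ) : ∀ k b, ∀ q ∈ compD K k b, (BD K).cubeScale q = k := by
  intro k b q hq
  unfold compD at hq
  split_ifs at hq with h
  · rw [Finset.mem_insert, Finset.mem_singleton] at hq
    rcases hq with rfl | rfl <;> rfl
  · simp at hq

/-- [folklore] Component volume `v = 2`. -/
theorem hvolD (K : ℕ) : ∀ k b, (compD K k b).card ≤ 2 := by
  intro k b; unfold compD; split_ifs
  · exact Finset.card_le_two
  · simp

/-- **THE VOLUME IS ATTAINED** [decided toy]: at every scale `k ≤ K` the met component is housed in EXACTLY two cubes. [folklore] -/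
theorem compD_card {K k : ℕ} (hk : k ≤ K) (b : Fin 2) : (compD K k b).card = 2 := by
  unfold compD
  rw [dif_pos hk]
  exact Finset.card_pair (by simp)

/-- [folklore] Live families below the cutoff: both. -/
theorem SD_of_le {K k : ℕ} (hk : k ≤ K) (b : Fin 2) : SD K k b = Finset.univ := if_pos hk

/-- [folklore] No live family above the cutoff. -/
theorem SD_of_not_le {K k : ℕ} (hk : ¬ k ≤ K) (b : Fin 2) : SD K k b = ∅ := if_neg hk

/-- [folklore] Live generations below the cutoff: both families' generation `0`. -/
theorem SgD_of_le {K k : ℕ} (hk : k ≤ K) (b : Fin 2) : SgD K k b = Finset.univ ×ˢ {0} := if_pos hk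

/-- [folklore] No live generation above the cutoff. -/
theorem SgD_of_not_le {K k : ℕ} (hk : ¬ k ≤ K) (b : Fin 2) : SgD K k b = ∅ := if_neg hk

/-- **LIVE FAMILIES ARE HOUSED — AND THE HOUSING CHOOSES** [decided toy]: at every scale `k ≤ K` the live family `f` is felt at the cube
`(k, f)` of the component (and at no other cube of the component: `feltAt (k, i) = {i}`). [folklore] -/
theorem hhousedD (K : ℕ) : ∀ k b, ∀ f ∈ SD K k b, ∃ q ∈ compD K k b, f ∈ (BD K).feltAt q := by
  intro k b f hf
  unfold SD at hf
  unfold compD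
  split_ifs at hf ⊢ with h
  · refine ⟨(⟨k, Nat.lt_succ_of_le h⟩, f), ?_, Finset.mem_singleton_self _⟩
    rw [Finset.mem_insert, Finset.mem_singleton]
    rcases Fin.exists_fin_two.mp ⟨f, rfl⟩ with hf0 | hf1
    · exact Or.inl (by rw [hf0])
    · exact Or.inr (by rw [hf1])
  · simp at hf

/-- **NO SINGLE CUBE HOUSES THE COMPONENT** [decided toy]: at every live scale the two live families are NOT felt at any one cube
(each cube feels one family) — so volume `v = 2` is NECESSARY for `hhoused`, not a slack bound. [folklore] -/
theorem not_housed_by_one_cube {K k : ℕ} (hk : k ≤ K) (b : Fin 2) (q : (BD K).Cube) :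
    ¬ (∀ f ∈ SD K k b, f ∈ (BD K).feltAt q) := by
  intro h
  have h0 : (0 : Fin 2) ∈ ({q.2} : Finset (Fin 2)) := h 0 (by rw [SD_of_le hk]; exact Finset.mem_univ _)
  have h1 : (1 : Fin 2) ∈ ({q.2} : Finset (Fin 2)) := h 1 (by rw [SD_of_le hk]; exact Finset.mem_univ _)
  rw [Finset.mem_singleton] at h0 h1
  exact absurd (h0.trans h1.symm) (by decide)

/-- [folklore] Membership in the live generations: a live family's generation `0`. -/
theorem mem_SgD {K k : ℕ} {b : Fin 2} {x : Fin 2 × ℕ} (hx : x ∈ SgD K k b) : x.1 ∈ SD K k b ∧ x.2 = 0 := by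
  unfold SgD at hx
  unfold SD
  split_ifs at hx ⊢ with h
  · rw [Finset.mem_product, Finset.mem_singleton] at hx
    exact ⟨Finset.mem_univ _, hx.2⟩
  · simp at hx

/-- `hSg` [decided toy]: a live generation is a live family's, born (scale `0`), not from the future. [folklore] -/
theorem hSgD (K : ℕ) : ∀ (k : ℕ) (b : Fin 2), ∀ p ∈ SgD K k b,
    p.1 ∈ SD K k b ∧ (BD K).birthScale p.1 ≤ p.2 ∧ p.2 ≤ k := by
  intro k b p hp
  obtain ⟨h1, h2⟩ := mem_SgD hp
  exact ⟨h1, Nat.zero_le _, h2 ▸ Nat.zero_le _⟩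

/-- **THE MET COMPONENT CARRIES TWO LIVE FAMILIES** at every scale `k ≤ K` [decided toy] — both born at scale `0`, so the positional count
the terminal face derives from the anchoring (`N₀·(Lb⁴)^{k−0}`, `N₀ = v·mB = 2`) is ATTAINED at `k = 0` (part 2). [folklore] -/
theorem liveFamilies_card {K k : ℕ} (hk : k ≤ K) (b : Fin 2) : (SD K k b).card = 2 := by
  rw [SD_of_le hk, Finset.card_univ, Fintype.card_fin]

/-! ## §4 The H2 dictionary as a TWO-term cross-family sum (the step law is W11r's `hFnT`) [decided toy] -/

/-- **THE DICTIONARY `hQ` AS AN EQUATION — A TWO-TERM LIVE CROSS-FAMILY SUM** [decided toy]: at scales `k ≤ K` the centred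
observable-attached exponent of the met component is `⅛·Σ_{(f,0), f ∈ {0,1}} (FnM K 0 k (U+z) − FnM K 0 k (U+0))`, each family
contributing `a_K·z₀₀` — which IS W7's `𝒬M K k U z = ¼·a_K·z₀₀`, i.e. W11r's cut exponent `𝒬T K k`; above the cutoff both sides
vanish. [folklore] -/
theorem hQD (K : ℕ) (b : Fin 2) (k : ℕ) :
    (fun U z => 𝒬T K k U z - (fun (_ : Fld 4 ℂ) => (0 : ℂ)) U) =
      fun U z => ((1 / 8 : ℝ) : ℂ) * ∑ p ∈ SgD K k b,
        (FnM K p.2 k (U + z) - FnM K p.2 k (U + (fun (_ : (BD K).Birth) (_ : ℕ) => (0 : Fld 4 ℂ)) b k)) := by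
  by_cases hk : k ≤ K
  · rw [𝒬T_of_le hk, SgD_of_le hk]
    funext U z
    simp only [Finset.sum_product, Finset.sum_singleton, Fin.sum_univ_two, FnM, ↓reduceIte, ev₀₀_add, add_zero, 𝒬M,
      sub_zero]
    push_cast
    ring
  · rw [𝒬T_of_not_le hk, SgD_of_not_le hk]
    funext U z
    simp [zeroExp]

/-- `hcm` [decided toy]: the source factor is `⅛ ≤ m = ⅛` (EQUALITY). [folklore] -/
theorem hcmD : ‖((1 / 8 : ℝ) : ℂ)‖ ≤ 1 / 8 := by
  rw [Complex.norm_real, Real.norm_eq_abs, abs_of_pos (by norm_num)]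

/-! ## §5 Births, the booking convention, the absorption door, regeneration — for both families, W7's content [decided toy] -/

/-- `hsl` (w1) for both families [decided toy]: W7's birth slice (the generation sizes of `TD` ARE W7's). [folklore] -/
theorem hslD (K : ℕ) (f : (BD K).Birth) (k' : ℕ) :
    BirthSlice (FnM K k' k') latMove latN (bondBall 4 (Wm.ρw k') : Set (Fld 4 ℂ)) 1 1 ((TD K).gen f k') :=
  hslM K () k'

/-- **THE BOOKED SIZE IS A REALISED INCREMENT** [decided toy]: for both families, `lin f k′ k` is EXACTLY the increment of the carried
functional along W7's pair `(0, latMove 0 (dirW (k+1)) 1)` — W11r's `osc_dirW`. [folklore] -/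
theorem lin_eq_increment (K : ℕ) (f : (BD K).Birth) (k' k : ℕ) :
    (TD K).lin f k' k = ‖FnM K k' k (latMove 0 (dirW (k + 1)) 1) - FnM K k' k 0‖ :=
  (osc_dirW K () k' k).symm

/-- **`hsup` — THE BOOKED SIZE IS BELOW THE SUP OF THE REALISED INCREMENTS, FOR BOTH FAMILIES** [decided toy]: `le_csSup` — the
realised-increment set is bounded above (W11r's `osc_le`) and contains the booked size (`lin_eq_increment`); row S8's booking convention
MET at every step of every cutoff; the `Real.sSup` is not junk.  (`hne` is W11r's `hneM`.) [folklore] -/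
theorem hsupD (K : ℕ) (f : (BD K).Birth) (k' k : ℕ) :
    (TD K).lin f k' k ≤ sSup {x : ℝ | ∃ U₀ ∈ (bondBall 4 (Wm.ρw k) : Set (Fld 4 ℂ)), ∃ U₁ : Fld 4 ℂ,
      RelGauge (fun U U' : Fld 4 ℂ => U = U') latMove latN U₀ U₁ (defW (k + 1)) ∧
        x = ‖FnM K k' k U₁ - FnM K k' k U₀‖} := by
  refine le_csSup ⟨(TM K).lin () k' k, ?_⟩ ?_
  · rintro x ⟨U₀, -, U₁, hrel, rfl⟩
    exact osc_le K () k' k hrel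
  · exact ⟨0, zero_mem_windowM k, latMove 0 (dirW (k + 1)) 1, ⟨dirW (k + 1), defW_pos (k + 1), le_rfl, rfl⟩,
      lin_eq_increment K f k' k⟩

/-- THE HISTORY-FREE ABSORPTION DOOR, WITH EQUALITY [decided toy]: `Sabs ≡ ∅`, `A = 0`, dressing `β K j := (LW⁻³)^K`; the birth
identity `2·gen f 0 = 2·a_K·(c_M + 3) = (LW⁻³)^K` for both families, ANY rate, ANY gate. [folklore] -/
theorem habsD (K : ℕ) (ρ : ℕ → ℝ) (Gate : ℕ → Prop) :
    (TD K).AbsorbsFrom (4 * (1 / 2) / 1) ρ (fun _ : ℕ => (LW⁻¹ ^ 3) ^ K) 0 (fun _ => ∅) Gate := by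
  intro b _ _
  simp only [Finset.sum_empty, mul_zero, add_zero]
  show 4 * (1 / 2) / 1 * (if (0 : ℕ) = 0 then aM K * (cM + 3) else 0) ≤ (LW⁻¹ ^ 3) ^ K
  have hc : 0 < cM + 3 := by linarith [cM_pos]
  rw [if_pos rfl]
  unfold aM
  rw [show 4 * (1 / 2 : ℝ) / 1 * ((LW⁻¹ ^ 3) ^ K / (2 * (cM + 3)) * (cM + 3)) = (LW⁻¹ ^ 3) ^ K by field_simp; ring]

/-- (w5) `hreg` [decided toy]: no regeneration (later generations are `0`), for ANY gate. [folklore] -/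
theorem hregD (K : ℕ) (Gate : ℕ → Prop) : (TD K).RegeneratesFromVar (fun _ : ℕ => (0 : ℝ)) Gate :=
  fun b k _ _ _ => by
    show (if k + 1 = 0 then aM K * (cM + 3) else 0) ≤ 0 * ((BD K).size b k)
    simp

end Summit.QuantumFields.BalabanUV.T4Continuum.NE1p.DressedTowerWitnessTwoCubes

end
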